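import Summits.ABC.StewartYu.PadicW80SizesLH
import HarnessLib

/-!
# The archimedean sizes at the `(log p)`-normalised parameter record, II (twin of p3's `PadicW80SizesB` on `PadicW80ParL`; cell abc-stewartyu, p1 stub S5)

`Summits/ABC/StewartYu/PadicW80SizesB.lean` — continuation of `PadicW80Sizes.lean` (cell
`abc-stewartyu`, seat p3; theorems only): for `S : CW77.Setup` at p1's parameters
`S₀ℓ, Lℓ, Lθℓ, J₀ℓ, Xptℓ`: `scale_le_T_pℓ` (`2^{J₀−J} ≤ T`), `scale_mul_le_Xptℓ` (the evaluation points
are `≤ X`), `abs_qΔ_le_pℓ` (`|qΔ| ≤ 𝔅`, Baker's `Δ`-polynomials at `x ≤ X`, `τ₀ ≤ T`),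
`card_box_le_𝔅_pℓ` (`#box_J ≤ 𝔅`).  The proofs are those of `Waldschmidt1980SizesB.lean`.

Everything is [folklore] book-keeping on [cite: Waldschmidt1980, §3.2 (p. 266), §3.4 (p. 269)].
-/

noncomputable section

open Finset Real
open Literature.NumberTheory.Transcendental
open Literature.NumberTheory.Transcendental.Baker1975
open Literature.NumberTheory.Transcendental.Baker1975.Ch3
open Literature.NumberTheory.Transcendental.CW77

namespace Literature.NumberTheory.Transcendental.CW77

namespace Setup

open Summit.ABC.StewartYu
open Summit.ABC.StewartYu.PadicW80Par (cLp' cTp cLp mRp)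
open Summit.ABC.StewartYu.PadicW80ParL (mR_pos two_le_mR)

variable {S : Setup} {P : PadicW80ParL S.d}

/-! ### The scale and the `Δ`-polynomials at the `p`-adic depth `J₀ᵖ` -/

/-- `scale(J₀ᵖ, J) = 2^{J₀ᵖ−J} ≤ 2 L_θᵖ ≤ T`. [cite: Waldschmidt1980, §3.4 (p. 269)] -/
theorem scale_le_T_pℓ (P : PadicW80ParL S.d) (J : ℕ) : scale P.J₀ℓ J ≤ P.Tℓ := by
  unfold scale
  have h1 : 2 ^ (P.J₀ℓ - J) ≤ 2 ^ P.J₀ℓ := Nat.pow_le_pow_right two_pos (Nat.sub_le _ _)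
  have h2 := P.two_pow_le
  have h3 : 2 * P.Lθℓ ≤ P.Tℓ := by
    have h := P.T_ge_Lθ
    have hm := two_le_mR P; have hV := P.one_le_nVθ
    have hL : (0 : ℝ) ≤ P.Lθℓ := Nat.cast_nonneg _
    have : (2 : ℝ) * P.Lθℓ ≤ 2 ^ 11 * mRp S.d ^ 2 * P.nVθ * P.Lθℓ := by
      have h4 : (2 : ℝ) ≤ 2 ^ 11 * mRp S.d ^ 2 * P.nVθ := by nlinarith
      nlinarith
    exact_mod_cast this.trans h
  omega

/-- **The evaluation points are `≤ Xᵖ`**: `scale(J₀ᵖ,J) · s ≤ Xᵖ = 66 · 2^{d+1} L_θᵖ S₀ᵖ` for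
`J ≤ J₀ᵖ` and `s ≤ 2^{d+1+J} S₀ᵖ`. [cite: Waldschmidt1980, §3.4 (p. 269)] -/
theorem scale_mul_le_Xptℓ (P : PadicW80ParL S.d) {J s : ℕ} (hJ : J ≤ P.J₀ℓ)
    (hs : s ≤ 2 ^ (S.d + 1 + J) * P.S₀ℓ) : ((scale P.J₀ℓ J * s : ℕ) : ℝ) ≤ P.Xptℓ := by
  have h1 : scale P.J₀ℓ J * s ≤ 2 ^ (S.d + 1) * (2 * P.Lθℓ) * P.S₀ℓ := by
    unfold scale
    calc 2 ^ (P.J₀ℓ - J) * s ≤ 2 ^ (P.J₀ℓ - J) * (2 ^ (S.d + 1 + J) * P.S₀ℓ) := Nat.mul_le_mul_left _ hs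
      _ = 2 ^ (S.d + 1) * 2 ^ P.J₀ℓ * P.S₀ℓ := by
          rw [show S.d + 1 + J = J + (S.d + 1) by ring, pow_add, ← Nat.mul_assoc, ← Nat.mul_assoc,
            ← pow_add, Nat.sub_add_cancel hJ]; ring
      _ ≤ 2 ^ (S.d + 1) * (2 * P.Lθℓ) * P.S₀ℓ :=
          Nat.mul_le_mul_right _ (Nat.mul_le_mul_left _ P.two_pow_le)
  have h2 : ((2 ^ (S.d + 1) * (2 * P.Lθℓ) * P.S₀ℓ : ℕ) : ℝ) ≤ P.Xptℓ := by
    unfold PadicW80ParL.Xptℓ; push_cast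
    have : (0 : ℝ) ≤ 2 ^ (S.d + 1) * P.Lθℓ * P.S₀ℓ := by positivity
    nlinarith
  exact le_trans (by exact_mod_cast h1) h2

/-- **`|qΔ| ≤ 𝔅`** at the `p`-adic depth: the rational values of the `Δ`-factors at the points
`x = 2^{J₀ᵖ−J} s ≤ Xᵖ`, `τ₀ ≤ T`. [cite: Waldschmidt1980, §3.4 (p. 269)] [cite: BakerTNT1975, Ch. 3 §2 Lemma 1] -/
theorem abs_qΔ_le_pℓ (P : PadicW80ParL S.d) {J : ℕ} (hJ : J ≤ P.J₀ℓ) (u : Idx S.d P.hparℓ P.Lbℓ)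
    {τ₀ s : ℕ} (hs : s ≤ 2 ^ (S.d + 1 + J) * P.S₀ℓ) (hτ : τ₀ ≤ P.Tℓ) :
    |(S.qΔ (h := P.hparℓ) P.J₀ℓ J u τ₀ s : ℝ)| ≤ P.𝔅ℓ := by
  set x := scale P.J₀ℓ J * s with hxdef
  have hxX : (x : ℝ) ≤ P.Xptℓ := S.scale_mul_le_Xptℓ P hJ hs
  set a : ℕ := (u.1.1 : ℕ) with ha
  set b : ℕ := (u.1.2 : ℕ) with hb
  have hR1 := P.one_le_hpar
  have hspec := (hdNat_spec (b := b) (le_of_lt u.1.1.isLt) x τ₀).2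
  have hνpos : (0 : ℝ) < ((nuBound x P.hparℓ) ^ τ₀ : ℕ) := by exact_mod_cast Nat.pow_pos (nuBound_pos _ _)
  have h1 : |(S.qΔ (h := P.hparℓ) P.J₀ℓ J u τ₀ s : ℝ)| ≤
      (τ₀.factorial : ℝ) * (scale P.J₀ℓ J : ℝ) ^ τ₀ *
        (2 ^ (a + b * P.hparℓ) * ((x + a).choose a * (x + P.hparℓ).choose P.hparℓ ^ b : ℕ) : ℝ) := by
    unfold qΔ
    rw [← hxdef]
    push_cast
    rw [abs_of_nonneg (by positivity), div_le_iff₀ (by push_cast at hνpos; exact_mod_cast hνpos)]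
    have hE : ((hdNat (b := b) (le_of_lt u.1.1.isLt) x τ₀ : ℕ) : ℝ) ≤
        ((2 ^ (a + b * P.hparℓ) * nuBound x P.hparℓ ^ τ₀ *
          ((x + a).choose a * (x + P.hparℓ).choose P.hparℓ ^ b) : ℕ) : ℝ) := by
      exact_mod_cast hspec
    push_cast at hE ⊢
    have h0 : (0 : ℝ) ≤ (τ₀.factorial : ℝ) * (scale P.J₀ℓ J : ℝ) ^ τ₀ := by positivity
    calc (τ₀.factorial : ℝ) * (scale P.J₀ℓ J : ℝ) ^ τ₀ * (hdNat (b := b) (le_of_lt u.1.1.isLt) x τ₀ : ℝ)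
        ≤ (τ₀.factorial : ℝ) * (scale P.J₀ℓ J : ℝ) ^ τ₀ *
          (2 ^ (a + b * P.hparℓ) * (nuBound x P.hparℓ : ℝ) ^ τ₀ *
            (((x + a).choose a : ℝ) * ((x + P.hparℓ).choose P.hparℓ : ℝ) ^ b)) :=
          mul_le_mul_of_nonneg_left hE h0
      _ = (τ₀.factorial : ℝ) * (scale P.J₀ℓ J : ℝ) ^ τ₀ *
          (2 ^ (a + b * P.hparℓ) * (((x + a).choose a : ℝ) * ((x + P.hparℓ).choose P.hparℓ : ℝ) ^ b)) *
            (nuBound x P.hparℓ : ℝ) ^ τ₀ := by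
          ring
  -- the four factors, each `≤ exp(𝔘/256)`
  have hT1 : (1 : ℝ) ≤ P.Tℓ := by exact_mod_cast P.one_le_T
  have hf1 : (τ₀.factorial : ℝ) ≤ Real.exp (P.𝔘ℓ / 256) := by
    have h2 : (τ₀.factorial : ℝ) ≤ (τ₀ : ℝ) ^ τ₀ := by exact_mod_cast Nat.factorial_le_pow τ₀
    have h3 : (τ₀ : ℝ) ^ τ₀ ≤ (P.Tℓ : ℝ) ^ τ₀ := pow_le_pow_left₀ (Nat.cast_nonneg _) (by exact_mod_cast hτ) _
    exact h2.trans (h3.trans (P.T_pow_le_p hτ))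
  have hf2 : (scale P.J₀ℓ J : ℝ) ^ τ₀ ≤ Real.exp (P.𝔘ℓ / 256) := by
    have h2 : (scale P.J₀ℓ J : ℝ) ≤ P.Tℓ := by exact_mod_cast S.scale_le_T_pℓ P J
    exact (pow_le_pow_left₀ (Nat.cast_nonneg _) h2 _).trans (P.T_pow_le_p hτ)
  have hab : a + b * P.hparℓ ≤ P.hparℓ * P.Lbℓ := by
    have ha' : a < P.hparℓ := u.1.1.isLt
    have hb' : b < P.Lbℓ := u.1.2.isLt
    calc a + b * P.hparℓ ≤ P.hparℓ + b * P.hparℓ := by omega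
      _ = (b + 1) * P.hparℓ := by ring
      _ ≤ P.Lbℓ * P.hparℓ := Nat.mul_le_mul_right _ hb'
      _ = P.hparℓ * P.Lbℓ := Nat.mul_comm _ _
  have hf3 : (2 : ℝ) ^ (a + b * P.hparℓ) ≤ Real.exp (P.𝔘ℓ / 256) :=
    (pow_le_pow_right₀ (by norm_num) hab).trans P.two_pow_hLb_le_p
  have hf4 : (((x + a).choose a * (x + P.hparℓ).choose P.hparℓ ^ b : ℕ) : ℝ) ≤ Real.exp (P.𝔘ℓ / 256) := by
    have hC : ((x + a).choose a : ℝ) ≤ (x + P.hparℓ).choose P.hparℓ := by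
      have : (x + a).choose a ≤ (x + P.hparℓ).choose P.hparℓ := by
        have e1 : (x + a).choose a = (x + a).choose x := (Nat.choose_symm_add (a := x) (b := a)).symm
        have e2 : (x + P.hparℓ).choose P.hparℓ = (x + P.hparℓ).choose x :=
          (Nat.choose_symm_add (a := x) (b := P.hparℓ)).symm
        rw [e1, e2]
        exact Nat.choose_le_choose x (by have := u.1.1.isLt; omega)
      exact_mod_cast this
    have hCe := choose_le_exp_mul_div_pow (x := x) hR1
    have hbase : 1 ≤ Real.exp 1 * ((x : ℝ) + P.hparℓ) / P.hparℓ := by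
      rw [le_div_iff₀ P.hpar_pos]
      have := Real.exp_one_gt_two; have := Nat.cast_nonneg (α := ℝ) x
      nlinarith
    push_cast
    calc ((x + a).choose a : ℝ) * ((x + P.hparℓ).choose P.hparℓ : ℝ) ^ b
        ≤ ((x + P.hparℓ).choose P.hparℓ : ℝ) ^ (b + 1) := by
          rw [pow_succ]; nlinarith [pow_nonneg (Nat.cast_nonneg (α := ℝ) ((x + P.hparℓ).choose P.hparℓ)) b]
      _ ≤ ((Real.exp 1 * (x + P.hparℓ) / P.hparℓ) ^ P.hparℓ) ^ (b + 1) := pow_le_pow_left₀ (Nat.cast_nonneg _) hCe _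
      _ = (Real.exp 1 * ((x : ℝ) + P.hparℓ) / P.hparℓ) ^ (P.hparℓ * (b + 1)) := by rw [← pow_mul]
      _ ≤ (Real.exp 1 * ((x : ℝ) + P.hparℓ) / P.hparℓ) ^ (P.hparℓ * P.Lbℓ) := by
          refine pow_le_pow_right₀ hbase (Nat.mul_le_mul_left _ ?_)
          exact u.1.2.isLt
      _ ≤ Real.exp (P.𝔘ℓ / 256) := P.ratio_pow_le_p hxX
  refine h1.trans ?_
  have hE := Real.exp_pos (P.𝔘ℓ / 256)
  calc (τ₀.factorial : ℝ) * (scale P.J₀ℓ J : ℝ) ^ τ₀ *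
        (2 ^ (a + b * P.hparℓ) * ((x + a).choose a * (x + P.hparℓ).choose P.hparℓ ^ b : ℕ) : ℝ)
      ≤ Real.exp (P.𝔘ℓ / 256) * Real.exp (P.𝔘ℓ / 256) * (Real.exp (P.𝔘ℓ / 256) * Real.exp (P.𝔘ℓ / 256)) := by
        refine mul_le_mul (mul_le_mul hf1 hf2 (by positivity) hE.le)
          (mul_le_mul hf3 hf4 (by positivity) hE.le) (by positivity) (by positivity)
    _ = Real.exp (P.𝔘ℓ / 256) ^ 4 := by ring
    _ = P.𝔅ℓ := P.exp_quarter_pow_four_p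

/-! ### The number of unknowns -/

/-- **`#box_J ≤ 𝔅`** for the `p`-adic ranges: `#box_J ≤ h L_b ∏ (Lallᵖᵢ + 1) ≤ (2U)^{d+2}`.
[cite: Waldschmidt1980, §3.2 (p. 266)] -/
theorem card_box_le_𝔅_pℓ (P : PadicW80ParL S.d) (J : ℕ) :
    ((S.box (h := P.hparℓ) (Lb := P.Lbℓ) P.Lℓ P.Lθℓ J).card : ℝ) ≤ P.𝔅ℓ := by
  rw [S.card_box]
  push_cast
  have hU := P.U_pos
  have hU1 : (1 : ℝ) ≤ P.Uℓ := by
    have h2 := P.𝔘_ge'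
    have h5 : P.𝔘ℓ ≤ P.Uℓ := by
      rw [P.U_eq]; have : (1 : ℝ) ≤ 2 ^ (S.d + 1) := one_le_pow₀ (by norm_num)
      nlinarith [P.𝔘_pos]
    linarith [show (1 : ℝ) ≤ 2 ^ 98 by norm_num]
  have hY : ∀ i, ((P.Lallℓ i / 2 ^ J : ℕ) : ℝ) + 1 ≤ 2 * P.Uℓ := by
    intro i
    have h1 : ((P.Lallℓ i / 2 ^ J : ℕ) : ℝ) ≤ P.Lallℓ i := by exact_mod_cast Nat.div_le_self _ _
    have h2 := P.Lallp_le_U i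
    linarith
  have hhLb : (P.hparℓ : ℝ) * P.Lbℓ ≤ 2 * P.Uℓ := by
    have h1 := P.hparLb_le; have h2 := P.Wstar_le_𝔘; have h3 := P.𝔘_pos
    have h5 : P.𝔘ℓ ≤ P.Uℓ := by
      rw [P.U_eq]; have : (1:ℝ) ≤ 2 ^ (S.d + 1) := one_le_pow₀ (by norm_num)
      nlinarith
    have : P.𝔘ℓ / cLp + 4 * P.Wstarℓ ≤ 2 * P.𝔘ℓ := by unfold cLp; nlinarith
    linarith
  have hprod : (∏ j, (((P.Lℓ j / 2 ^ J : ℕ) : ℝ) + 1)) ≤ (2 * P.Uℓ) ^ S.d := by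
    calc (∏ j, (((P.Lℓ j / 2 ^ J : ℕ) : ℝ) + 1)) ≤ ∏ _j : Fin S.d, (2 * P.Uℓ) :=
          prod_le_prod (fun j _ => by positivity) fun j _ => by simpa using hY (Fin.castSucc j)
      _ = (2 * P.Uℓ) ^ S.d := by simp
  have hθ : (((P.Lθℓ / 2 ^ J : ℕ) : ℝ) + 1) ≤ 2 * P.Uℓ := by simpa using hY (Fin.last S.d)
  have htot : (P.hparℓ : ℝ) * P.Lbℓ * ((∏ j, (((P.Lℓ j / 2 ^ J : ℕ) : ℝ) + 1)) * (((P.Lθℓ / 2 ^ J : ℕ) : ℝ) + 1)) ≤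
      (2 * P.Uℓ) ^ (S.d + 2) := by
    calc (P.hparℓ : ℝ) * P.Lbℓ * ((∏ j, (((P.Lℓ j / 2 ^ J : ℕ) : ℝ) + 1)) * (((P.Lθℓ / 2 ^ J : ℕ) : ℝ) + 1))
        ≤ (2 * P.Uℓ) * ((2 * P.Uℓ) ^ S.d * (2 * P.Uℓ)) := by
          refine mul_le_mul hhLb (mul_le_mul hprod hθ (by positivity) (by positivity)) (by positivity) (by positivity)
      _ = (2 * P.Uℓ) ^ (S.d + 2) := by ring
  refine htot.trans (P.le_𝔅_of_log_le ?_)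
  rw [Real.log_pow, Real.log_mul (by norm_num) hU.ne']
  have hlog := P.log_U_le
  have hl2 : Real.log 2 ≤ 1 := by linarith [Real.log_two_lt_d9]
  have hmW := P.mW_le_𝔘_p; have hW := P.one_le_Wstar; have h𝔘 := P.𝔘_pos
  have hm : ((S.d + 2 : ℕ) : ℝ) ≤ 2 * mRp S.d := by
    have hd1 : (1 : ℝ) ≤ S.d := by exact_mod_cast P.hd
    unfold mRp; push_cast; linarith
  calc ((S.d + 2 : ℕ) : ℝ) * (Real.log 2 + Real.log P.Uℓ) ≤ (2 * mRp S.d) * (1 + 10 * P.Wstarℓ) := by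
        refine mul_le_mul hm (by linarith) ?_ (by have := PadicW80ParL.mR_pos P; linarith)
        have : 0 ≤ Real.log P.Uℓ := Real.log_nonneg hU1
        have : 0 ≤ Real.log 2 := Real.log_nonneg one_le_two
        linarith
    _ ≤ (2 * mRp S.d) * (11 * P.Wstarℓ) := by
        refine mul_le_mul_of_nonneg_left (by linarith) (by have := PadicW80ParL.mR_pos P; linarith)
    _ = 22 * (mRp S.d * P.Wstarℓ) := by ring
    _ ≤ P.𝔘ℓ / 64 := by nlinarith

end Setup

end Literature.NumberTheory.Transcendental.CW77

end
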